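import Summits.BirchSwinnertonDyer.BirchSwinnertonDyer.Theses.ByReductionTypeAtTwo
import Literature.NumberTheory.EllipticCurves.GaloisAction
import HarnessLib

/-! # Birth skeleton v2 (BC3/BC5) for K4 crux `OrdMissingLowerBoundAtTwo`
(item stmt-BirchSwinnertonDyer-19577, rider K-6; planner bsd-2adic-plan GEN 13 → GEN 14, 2026-08-26).
Two registered stubs by RATIONAL 2-TORSION (the two descent machineries: full 2-descent over the cubic field vs 2-isogeny
descent) and ONE kernel-checked CLOSED composition `OrdMissingLowerBoundAtTwo_of` over the stub names (v1 failed
`skeleton.extra-hypothesis`). First rung (BC5, LANDED p438804, ord GEN 7):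
`Summit.BirchSwinnertonDyer.BirchSwinnertonDyer.Theorems.GVISeed.missingLowerBoundAt_two_32505h1` (class 32505h, E[2]
irreducible — outside every door of record; 574/609 rank-0 classes certified by PARI, CENSUS-19272.md v2). -/

set_option autoImplicit false
-- the Cruxes namespace of this sub repeats the summit name by design (D-0017 nested layout)
set_option linter.dupNamespace false

namespace Summit.BirchSwinnertonDyer.BirchSwinnertonDyer.Cruxes.OrdMissingLowerBoundAtTwo.Birth

open WeierstrassCurve Literature.NumberTheory.EllipticCurves Literature.NumberTheory.EllipticCurves.Rank1Residual
  Literature.NumberTheory.EllipticCurves.Rank1Residual.Typed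
  Summit.BirchSwinnertonDyer.BirchSwinnertonDyer.Theses.ByReductionTypeAtTwo

/-- stub (no rational 2-torsion): ord₂ #Ш_an ≤ ord₂ #Ш[2^∞] via 2-descent (+ Cassels–Tate) when E(ℚ)[2] = 0. -/
theorem stub_oddTorsion : ∀ (W : WeierstrassCurve ℚ) [W.IsElliptic] [W.IsGloballyMinimal], ¬ W.HasCM → W.analyticRank = 0 →
    GoodOrd W 2 → ¬ 2 ∣ W.torsionOrder → MissingLowerBoundAt W 2 := by
  sorry

/-- stub (rational 2-torsion): the same inequality via 2-isogeny descents when 2 ∣ #E(ℚ)_tors. -/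
theorem stub_evenTorsion : ∀ (W : WeierstrassCurve ℚ) [W.IsElliptic] [W.IsGloballyMinimal], ¬ W.HasCM → W.analyticRank = 0 →
    GoodOrd W 2 → 2 ∣ W.torsionOrder → MissingLowerBoundAt W 2 := by
  sorry

/-- composition (CLOSED over the two stub names; the ONLY theorem of this file concluding the crux). -/
theorem OrdMissingLowerBoundAtTwo_of : OrdMissingLowerBoundAtTwo := by
  show Summit.BirchSwinnertonDyer.BirchSwinnertonDyer.Theorems.OrdHalvesAtTwo.OrdMissingLowerBoundAtTwo
  intro W _ _ hcm hr hgo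
  by_cases h : 2 ∣ W.torsionOrder
  · exact stub_evenTorsion W hcm hr hgo h
  · exact stub_oddTorsion W hcm hr hgo h

end Summit.BirchSwinnertonDyer.BirchSwinnertonDyer.Cruxes.OrdMissingLowerBoundAtTwo.Birth
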